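import Literature.NumberTheory.LFunctions.WeilFirstPrimeCertificateACells
import Literature.NumberTheory.LFunctions.WeilFirstPrimeCertificateANu2
import Literature.NumberTheory.LFunctions.WeilFirstPrimeCertificateABlock0
import Literature.NumberTheory.LFunctions.WeilFirstPrimeCertificateABlock1
import Literature.NumberTheory.LFunctions.WeilFirstPrimeQuadratic
import HarnessLib

/-!
# First-prime Weil positivity on `C(2/5)` (Stage A of the first-prime ladder)

`WeilPositivityOn (2/5)`: Weil's quadratic functional satisfies `Re W(g ⋆ g̃) ≥ 0` for every smooth `g`
with `tsupport g ⊆ [-2/5, 2/5]` — beyond Yoshida's archimedean range `(log 2)/2 ≈ 0.3466`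
(`weilPositivityOn_log_two_half_holds`), where the prime `2` enters the explicit formula. Proof: on
`C((log 3)/2) ⊇ C(2/5)` the functional is the first-prime analytic form `E₂(g)`
(`weilQuadratic_re_eq_weilFirstPrimeQuadratic`, `WeilFirstPrimeQuadratic.lean`), and `E₂ ≥ 0` on
`C(2/5)` by the kernel-checked moment-method certificate `weilCert2A`
(`WeilCert2.weilFirstPrimeQuadratic_nonneg_of_check`, `WeilFirstPrimeCertificate.lean`; data and kernel
evaluations in `WeilFirstPrimeCertificateDataA.lean` and its siblings). As in Yoshida's proof of the
archimedean case (Adv. Stud. Pure Math. 21 (1992), Thm 1, §6), the finite part is a machine computation,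
here performed by the Lean kernel (`decide +kernel`, no additional axioms).
-/

noncomputable section

namespace Literature.NumberTheory.LFunctions

/-- The Stage A certificate passes the checker. [folklore] -/
theorem weilCert2A_check : weilCert2A.check = true := by
  unfold WeilCert2.check
  rw [checkCells₂_weilCert2A, checkScalars_weilCert2A, checkNu_weilCert2A, checkBlock0_weilCert2A,
    checkBlock1_weilCert2A]
  rfl

/-- The first-prime analytic form is non-negative on `C(2/5)`: `0 ≤ E₂(g)` for every Weil test function
`g` with `tsupport g ⊆ [-2/5, 2/5]`. [folklore] -/
theorem weilFirstPrimeQuadratic_nonneg_two_fifths {g : ℝ → ℂ} (hg : IsWeilTest g)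
    (hsupp : tsupport g ⊆ Set.Icc (-(2 / 5 : ℝ)) (2 / 5)) : 0 ≤ weilFirstPrimeQuadratic g := by
  have h := WeilCert2.weilFirstPrimeQuadratic_nonneg_of_check weilCert2A_check hg
    (by have e : ((weilCert2A.b : ℚ) : ℝ) = 2 / 5 := by norm_num [weilCert2A]
        rw [e]; exact hsupp)
  unfold weilFirstPrimeQuadratic weilFirstPrimeWeight
  exact h

/-- `2/5 ≤ (log 3)/2` (`e^0.8 ≤ e ≤ 3`). [folklore] -/
theorem two_fifths_le_log_three_half : (2 / 5 : ℝ) ≤ Real.log 3 / 2 := by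
  rw [le_div_iff₀ (by norm_num : (0 : ℝ) < 2), Real.le_log_iff_exp_le (by norm_num : (0 : ℝ) < 3)]
  calc Real.exp (2 / 5 * 2) ≤ Real.exp 1 := Real.exp_le_exp.2 (by norm_num)
    _ ≤ 3 := by linarith [Real.exp_one_lt_d9]

/-- **First-prime Weil positivity on `C(2/5)`**: `WeilPositivityOn (2/5)`. [folklore] -/
theorem weilPositivityOn_two_fifths : WeilPositivityOn (2 / 5) := by
  intro g hg hsupp
  have hsupp' : tsupport g ⊆ Set.Icc (-(Real.log 3 / 2)) (Real.log 3 / 2) :=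
    hsupp.trans (Set.Icc_subset_Icc (by linarith [two_fifths_le_log_three_half]) two_fifths_le_log_three_half)
  rw [weilQuadratic_re_eq_weilFirstPrimeQuadratic hg hsupp']
  exact weilFirstPrimeQuadratic_nonneg_two_fifths hg hsupp

/-- Weil positivity on `[-a, a]` for every `a ≤ 2/5`. [folklore] -/
theorem weilPositivityOn_of_le_two_fifths {a : ℝ} (ha : a ≤ 2 / 5) : WeilPositivityOn a :=
  WeilPositivityOn.mono ha weilPositivityOn_two_fifths

end Literature.NumberTheory.LFunctions
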